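import Summits.QuantumAdvantage.QuantumAdvantage.Theorems.CubicForrelationSignedExactCubicForrelationNotPrBPPGrowMachineClosure
import Literature.Computability.Complexity.CodeFPTableKit

/-!
# Crux `CubicForrelation.SignedExactCubicForrelationNotPrBPP` (stmt-QuantumAdvantage-13932), line `dual-pingpong-frame`
# (GROW reshape): the GROW machine, III — trials, the run on the coins, the output gate, `growFind ∈ FP`, soundness

Support file (`--supports stmt-QuantumAdvantage-13932`) toward the registered stub `stub_growFinder`; sequel of
`…GrowMachineBricks.lean`, `…GrowMachineClosure.lean`. The coin finder `growFind ⟨x, y⟩` (`x` an instance code,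
`y` the coins) is written, as `FinderMachine.findV2`, as plain functions of the mirror instance and certified
polynomial time by the typed algebra `CodeFP`; `growFind` is the `FP` witness of `growFindI_codeFP` (by choice), so
`growFind ⟨encode I, y⟩ = encList (growCore (instOf I) |encode I| y)` (`growFind_encode`).

**The algorithm** (`growCore`; guard `k = 2 ∧ n ≤ |x| + 1` as `findV2`, else output `[]`; `n` the dimension,
`m = n / 2`, `c_f`, `c_g` the codes of `f = C₀`, `g = C₁`). STATE: a pair `(S, U)` of row lists (bases of the
`g`-side and `f`-side subspaces), initially `([], [])`. COINS: `numTrials n = 3 n (n+2)⁹` consecutive chunks of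
`chunkLen n = (n+2) n` coins; chunk = selector `sel` (`n` bits) followed by `n + 1` probes `x₀ … x_n` (`n` bits each).
TRIAL on a chunk (`trialC`): a terminal state (`|S| = m` or `|U| = m`) is kept; otherwise the first successful JOB
`j < 2 (n+2)` is applied (`tryJob`: `j` even — the `b`-side step `tryB` with the first `j / 2` probes; `j` odd — the
`a`-side step `tryA`), where a step computes the candidate `v ∈ K = Z(S) ∩ U^⊥ ∩ ⋂ rad B_{xⱼ}` selected by `sel`,
rejects it if `v ∈ span S`, closes `(basis (S ++ [v]), U)` by `n + 1` rounds of the two-sided offset closure and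
accepts iff the result is closed both ways, has both ranks `≤ m` and is orthogonal (file II). OUTPUT (`rowsOut`,
`outCtx`): the rows `0ⁿ :: S` if `|S| = m`, else `0ⁿ :: (kernel basis of U)`, released only if they pass
`MMReadout.certOK n c_g` (rank `n / 2` and vanishing second differences of `g` along row pairs at `0ⁿ` and the unit
vectors); otherwise `[]`. The leading zero row makes a certified output non-empty without changing its span.

PROVED here: `growFind_mem_FP` (the run is a shape-invariant `foldlInv` fold over the chunk indices) and the
SOUNDNESS `growFind_sound` — on every coin string a non-empty output spans an M-subspace of `g` — literally the
argument of `FinderMachine.findV2_sound` from the `certOK` gate (`card_VL`, `stub_certify`). Completeness (output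
non-empty with probability `≥ 2/3` on the Maiorana–McFarland slice, from the line's `KernelStats` and `MPairClosed`)
is the subject of the sequel files.

## References

* S. Arora, B. Barak, *Computational Complexity: A Modern Approach*, CUP 2009, §1.3, §7.1. [AroraBarak2009]
* C. Carlet, *Boolean Functions for Cryptography and Coding Theory*, CUP 2021, Prop. 54. [Carlet2020]
* O. Goldreich, *On promise problems*, 2006, Def. 1.2. [Goldreich2006]
-/

noncomputable section

set_option linter.dupNamespace false -- D-0017: single-problem summit ⇒ `QuantumAdvantage.QuantumAdvantage` by design

namespace Summit.QuantumAdvantage.QuantumAdvantage.Theorems.SignedExactCubicForrelationNotPrBPP.GrowMachine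

open _root_.Computability Literature.Computability.Complexity Literature.Computability.Complexity.CodeFP
open Literature.Computability.QuantumComplexity
open Literature.Computability.Complexity.F2Elim (bxorL Row rrun isPiv prow kvec bitsE stCE)
open ForrCode QuadSampler CubicDequant MMReadout
open FinderMachine (Vec Mat matE normV basisOf kerOf inSpan shaped_basisOf basisOf_codeFP kerOf_codeFP inSpan_codeFP
  normV_codeFP shapeP shapeP_eval length_matE_le length_matE_le_shapeP foldlInv)

/-! ### The machine: jobs, trials, the run, the output gate, the guard -/

/-- **Job `j`** of a trial: for `j` even the `b`-side step with the first `j / 2` probes, for `j` odd the `a`-side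
step. [cite: Carlet2020, Prop. 54] -/
def tryJob (n m : ℕ) (cf cg : PCirc) (p : Mat × Mat) (xs : Mat) (sel : Vec) (j : ℕ) : Option (Mat × Mat) :=
  if decide (j % 2 = 0) then tryB n m cf cg p (xs.take (j / 2)) sel else tryA n m cf cg p (xs.take (j / 2)) sel

/-- The probes of a chunk: `xⱼ = chunk[(j+1) n, (j+2) n)`, `j ≤ n`. [folklore] -/
def probesOf (n : ℕ) (c : Vec) : Mat := (List.range (n + 1)).map fun j => coinVec c n ((j + 1) * n)

/-- The selector of a chunk: its first `n` bits. [folklore] -/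
def selOf (n : ℕ) (c : Vec) : Vec := coinVec c n 0

/-- A state is TERMINAL when one side has reached rank `m`. [folklore] -/
def terminal (m : ℕ) (p : Mat × Mat) : Bool := decide (p.1.length = m) || decide (p.2.length = m)

/-- **A trial** on a chunk: keep a terminal state; otherwise apply the first successful job, if any.
[cite: Carlet2020, Prop. 54] -/
def trialC (n m : ℕ) (cf cg : PCirc) (p : Mat × Mat) (c : Vec) : Mat × Mat :=
  if terminal m p then p else ((List.range (2 * (n + 2))).findSome? (tryJob n m cf cg p (probesOf n c) (selOf n c))).getD p

/-- The chunk length `(n + 2) n`. [folklore] -/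
def chunkLen (n : ℕ) : ℕ := (n + 2) * n

/-- The number of trials `n · 3 (n+2)⁹` (`n` stages of `3 (n+2)⁹` trials). [folklore] -/
def numTrials (n : ℕ) : ℕ := n * (3 * (n + 2) ^ 9)

/-- **The run on the coins** `y`: the trials on the consecutive chunks, from `([], [])`. [cite: AroraBarak2009, §7.1] -/
def runY (n m : ℕ) (cf cg : PCirc) (y : Vec) : Mat × Mat :=
  (List.range (numTrials n)).foldl (fun p t => trialC n m cf cg p (coinVec y (chunkLen n) (t * chunkLen n))) ([], [])

/-- **The output rows** of a state: `0ⁿ :: S` if `|S| = m`, else `0ⁿ ::` a kernel basis of `U`. [cite: Carlet2020, Prop. 54] -/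
def rowsOut (n m : ℕ) (p : Mat × Mat) : Mat := zeroL n :: (if decide (p.1.length = m) then p.1 else kerOf n p.2)

/-- **The output gate**: the output rows of the run, released only if `MMReadout.certOK` passes. [cite: Carlet2020, Prop. 54] -/
def outCtx (n m : ℕ) (cf cg : PCirc) (y : Vec) : Mat :=
  if certOK n cg (rowsOut n m (runY n m cf cg y)) then rowsOut n m (runY n m cf cg y) else []

/-- **The finder on a mirror instance** `t` with code length `ℓ` and coins `y`: guard `k = 2 ∧ n ≤ ℓ + 1`, then the
gated output in the context `(nEff, nEff / 2, C₀, C₁)`; `[]` off the guard. [cite: Goldreich2006, Def. 1.2] -/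
def growCore (t : Inst) (ℓ : ℕ) (y : Vec) : Mat :=
  if decide (t.2.1 = 2) && decide (t.1 ≤ ℓ + 1) then outCtx (nEff t ℓ) (nEff t ℓ / 2) (circAt t 0) (circAt t 1) y else []

/-! ### Shapes of the run states -/

/-- A successful job returns a shaped pair (from a shaped pair). [folklore] -/
theorem shaped_tryJob (n m : ℕ) (cf cg : PCirc) {p : Mat × Mat} (h1 : (p.1).length ≤ n ∧ ∀ r ∈ p.1, r.length ≤ n)
    (h2 : (p.2).length ≤ n ∧ ∀ r ∈ p.2, r.length ≤ n) (xs : Mat) (sel : Vec) (j : ℕ) {q : Mat × Mat}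
    (hq : tryJob n m cf cg p xs sel j = some q) : ((q.1).length ≤ n ∧ ∀ r ∈ q.1, r.length ≤ n) ∧ ((q.2).length ≤ n ∧ ∀ r ∈ q.2, r.length ≤ n) := by
  unfold tryJob at hq
  split_ifs at hq
  · exact shaped_tryB n m cf cg h2 _ sel hq
  · exact shaped_tryA n m cf cg h1 _ sel hq

/-- A trial keeps the shape. [folklore] -/
theorem shaped_trialC (n m : ℕ) (cf cg : PCirc) {p : Mat × Mat} (h1 : (p.1).length ≤ n ∧ ∀ r ∈ p.1, r.length ≤ n)
    (h2 : (p.2).length ≤ n ∧ ∀ r ∈ p.2, r.length ≤ n) (c : Vec) :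
    (((trialC n m cf cg p c).1).length ≤ n ∧ ∀ r ∈ (trialC n m cf cg p c).1, r.length ≤ n) ∧
      (((trialC n m cf cg p c).2).length ≤ n ∧ ∀ r ∈ (trialC n m cf cg p c).2, r.length ≤ n) := by
  unfold trialC; split_ifs
  · exact ⟨h1, h2⟩
  generalize hfs : List.findSome? _ _ = o
  cases o with
  | none => exact ⟨h1, h2⟩
  | some q => obtain ⟨j, -, hj⟩ := List.exists_of_findSome?_eq_some hfs; exact shaped_tryJob n m cf cg h1 h2 _ _ j hj

/-! ### Polynomial time -/

/-- **Jobs on codes**: `((Γ, (p, (xs, sel))), j) ↦ tryJob n m c_f c_g p xs sel j`. [cite: AroraBarak2009, §1.3] -/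
theorem tryJob_codeFP : CodeFP (pairE TBE natE) (optE prE) (fun t => tryJob t.1.1.1 t.1.1.2.1 t.1.1.2.2.1 t.1.1.2.2.2 t.1.2.1 t.1.2.2.1 t.1.2.2.2 t.2) := by
  have hΓ : CodeFP (pairE TBE natE) G4E (fun t => t.1.1) := (fst _ _).fst'
  have hp : CodeFP (pairE TBE natE) prE (fun t => t.1.2.1) := (fst _ _).snd'.fst'
  have hxs : CodeFP (pairE TBE natE) matE (fun t => t.1.2.2.1) := (fst _ _).snd'.snd'.fst'
  have hsel : CodeFP (pairE TBE natE) bitsE (fun t => t.1.2.2.2) := (fst _ _).snd'.snd'.snd'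
  have hj : CodeFP (pairE TBE natE) natE (fun t => t.2) := snd _ _
  have hc := natEq.comp ((natMod.comp (hj.pair (const _ 2))).pair (const _ 0))
  have htk := (rawTakeNat bitsE).comp ((natDiv.comp (hj.pair (const _ 2))).pair hxs)
  have hctx := hΓ.pair (hp.pair (htk.pair hsel))
  exact (hc.ite (tryB_codeFP.comp hctx) (tryA_codeFP.comp hctx)).congr fun _ => rfl

/-- The probes on codes: `(n, c) ↦ probesOf n c`. [cite: AroraBarak2009, §1.3] -/
theorem probesOf_codeFP : CodeFP (pairE unE bitsE) matE (fun t => probesOf t.1 t.2) := by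
  have hn : CodeFP (pairE (pairE unE bitsE) natE) unE (fun q => q.1.1) := (fst _ _).fst'
  have hc : CodeFP (pairE (pairE unE bitsE) natE) strE (fun q => q.1.2) := bitsToStr.comp (fst _ _).snd'
  have hj : CodeFP (pairE (pairE unE bitsE) natE) natE (fun q => q.2) := snd _ _
  have hoff := natMul.comp ((natAdd.comp (hj.pair (const _ 1))).pair (natOfUn.comp hn))
  have hg := coinVec_codeFP.comp (hc.pair (hn.pair hoff))
  have hm := CodeFP.map (σ := ℕ × Vec) (eσ := pairE unE bitsE) (eα := natE) (eβ := bitsE)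
    (g := fun q => coinVec q.1.2 q.1.1 ((q.2 + 1) * q.1.1)) hg
  exact (hm.comp ((CodeFP.id _).pair (urange.comp (unSucc.comp (fst _ _))))).congr fun _ => rfl

/-- The selector on codes. [cite: AroraBarak2009, §1.3] -/
theorem selOf_codeFP : CodeFP (pairE unE bitsE) bitsE (fun t => selOf t.1 t.2) :=
  (coinVec_codeFP.comp ((bitsToStr.comp (snd _ _)).pair ((fst _ _).pair (const _ 0)))).congr fun _ => rfl

/-- The code of the trial context `(Γ, (p, c))`. [folklore] -/
abbrev TRE : (ℕ × (ℕ × (PCirc × PCirc))) × ((Mat × Mat) × Vec) → List Bool := pairE G4E (pairE prE bitsE)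

/-- **Trials on codes**: `(Γ, (p, c)) ↦ trialC n m c_f c_g p c`. [cite: AroraBarak2009, §1.3] -/
theorem trialC_codeFP : CodeFP TRE prE (fun t => trialC t.1.1 t.1.2.1 t.1.2.2.1 t.1.2.2.2 t.2.1 t.2.2) := by
  have hΓ : CodeFP TRE G4E (fun t => t.1) := fst _ _
  have hn : CodeFP TRE unE (fun t => t.1.1) := (fst _ _).fst'
  have hm : CodeFP TRE unE (fun t => t.1.2.1) := (fst _ _).snd'.fst'
  have hp : CodeFP TRE prE (fun t => t.2.1) := (snd _ _).fst'
  have hc : CodeFP TRE bitsE (fun t => t.2.2) := (snd _ _).snd'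
  have hterm := (natEq.comp (((natLength bitsE).comp hp.fst').pair (natOfUn.comp hm))).or
    (natEq.comp (((natLength bitsE).comp hp.snd').pair (natOfUn.comp hm)))
  have hctx : CodeFP TRE TBE (fun t => (t.1, (t.2.1, (probesOf t.1.1 t.2.2, selOf t.1.1 t.2.2)))) :=
    hΓ.pair (hp.pair ((probesOf_codeFP.comp (hn.pair hc)).pair (selOf_codeFP.comp (hn.pair hc))))
  have hfind := findSomeFP (σ := (ℕ × (ℕ × (PCirc × PCirc))) × ((Mat × Mat) × (Mat × Vec))) (eσ := TBE) (eα := natE) (eβ := prE)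
    (f := fun q => tryJob q.1.1.1 q.1.1.2.1 q.1.1.2.2.1 q.1.1.2.2.2 q.1.2.1 q.1.2.2.1 q.1.2.2.2 q.2) tryJob_codeFP
  have hjobs : CodeFP TRE (rawE natE) (fun t => List.range (2 * (t.1.1 + 2))) := urange.comp ((unMulConst 2).comp (unSucc.comp (unSucc.comp hn)))
  have hget := (optGetD prE).comp ((hfind.comp (hctx.pair hjobs)).pair hp)
  exact (hterm.ite hp hget).congr fun _ => rfl

/-- The code of the run context `(Γ, y)`. [folklore] -/
abbrev RNE : (ℕ × (ℕ × (PCirc × PCirc))) × Vec → List Bool := pairE G4E strE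

/-- A run context code is at least `n` long. [folklore] -/
theorem n_le_length_RNE (c : (ℕ × (ℕ × (PCirc × PCirc))) × Vec) : c.1.1 ≤ (RNE c).length := by
  simp only [pairE_apply, length_boolPair, length_unE]; omega

/-- **The run on codes**: `(Γ, y) ↦ runY n m c_f c_g y` (a shape-invariant fold over the chunk indices).
[cite: AroraBarak2009, §1.3] -/
theorem runY_codeFP : CodeFP RNE prE (fun t => runY t.1.1 t.1.2.1 t.1.2.2.1 t.1.2.2.2 t.2) := by
  -- the step `((Γ, y), (t, p)) ↦ trialC Γ p (coinVec y C (t C))`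
  have hΓ : CodeFP (pairE RNE (pairE natE prE)) G4E (fun q => q.1.1) := (fst _ _).fst'
  have hn : CodeFP (pairE RNE (pairE natE prE)) unE (fun q => q.1.1.1) := (fst _ _).fst'.fst'
  have hy : CodeFP (pairE RNE (pairE natE prE)) strE (fun q => q.1.2) := (fst _ _).snd'
  have ht : CodeFP (pairE RNE (pairE natE prE)) natE (fun q => q.2.1) := (snd _ _).fst'
  have hp : CodeFP (pairE RNE (pairE natE prE)) prE (fun q => q.2.2) := (snd _ _).snd'
  have hC : CodeFP (pairE RNE (pairE natE prE)) unE (fun q => chunkLen q.1.1.1) :=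
    ((unPoly ((Polynomial.X + 2) * Polynomial.X)).comp hn).congr fun q => by simp [chunkLen]
  have hoff := natMul.comp (ht.pair (natOfUn.comp hC))
  have hcv := coinVec_codeFP.comp (hy.pair (hC.pair hoff))
  have hstep := trialC_codeFP.comp (hΓ.pair (hp.pair hcv))
  have hfold := foldlInv (σ := (ℕ × (ℕ × (PCirc × PCirc))) × Vec) (α := ℕ) (β := Mat × Mat) (eσ := RNE) (eα := natE) (eβ := prE)
    (step := fun c t p => trialC c.1.1 c.1.2.1 c.1.2.2.1 c.1.2.2.2 p (coinVec c.2 (chunkLen c.1.1) (t * chunkLen c.1.1)))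
    (init := fun _ => ([], []))
    (fun c p => ((p.1).length ≤ c.1.1 ∧ ∀ r ∈ p.1, r.length ≤ c.1.1) ∧ ((p.2).length ≤ c.1.1 ∧ ∀ r ∈ p.2, r.length ≤ c.1.1))
    hstep (const _ ([], [])) (3 * shapeP + 2)
    (fun c => ⟨⟨Nat.zero_le _, fun _ h => absurd h List.not_mem_nil⟩, ⟨Nat.zero_le _, fun _ h => absurd h List.not_mem_nil⟩⟩)
    (fun c t p hp => shaped_trialC _ _ _ _ hp.1 hp.2 _)
    (fun c p hp => by
      have h1 := length_matE_le_shapeP hp.1 (n_le_length_RNE c)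
      have h2 := length_matE_le_shapeP hp.2 (n_le_length_RNE c)
      show (boolPair (matE p.1) (matE p.2)).length ≤ _
      rw [length_boolPair]
      simp only [Polynomial.eval_add, Polynomial.eval_mul, Polynomial.eval_ofNat]
      omega)
  have hN : CodeFP RNE (rawE natE) (fun c => List.range (numTrials c.1.1)) :=
    (urange.comp ((unPoly (Polynomial.X * (3 * (Polynomial.X + 2) ^ 9))).comp (fst G4E strE).fst')).congr fun c => by simp [numTrials]
  exact (hfold.comp ((CodeFP.id _).pair hN)).congr fun _ => rfl

/-- **The output rows on codes**: `((n, m), p) ↦ rowsOut n m p`. [cite: AroraBarak2009, §1.3] -/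
theorem rowsOut_codeFP : CodeFP (pairE (pairE unE unE) prE) matE (fun t => rowsOut t.1.1 t.1.2 t.2) := by
  have hn : CodeFP (pairE (pairE unE unE) prE) unE (fun t => t.1.1) := (fst _ _).fst'
  have hm : CodeFP (pairE (pairE unE unE) prE) unE (fun t => t.1.2) := (fst _ _).snd'
  have hS : CodeFP (pairE (pairE unE unE) prE) matE (fun t => t.2.1) := (snd _ _).fst'
  have hU : CodeFP (pairE (pairE unE unE) prE) matE (fun t => t.2.2) := (snd _ _).snd'
  have hc := natEq.comp (((natLength bitsE).comp hS).pair (natOfUn.comp hm))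
  have hrows := hc.ite hS (kerOf_codeFP.comp (hn.pair hU))
  exact ((rawCons bitsE).comp ((zeroL_codeFP.comp hn).pair hrows)).congr fun _ => rfl

/-- **The gated output on codes**: `(Γ, y) ↦ outCtx n m c_f c_g y`. [cite: AroraBarak2009, §1.3] -/
theorem outCtx_codeFP : CodeFP RNE matE (fun t => outCtx t.1.1 t.1.2.1 t.1.2.2.1 t.1.2.2.2 t.2) := by
  have hn : CodeFP RNE unE (fun t => t.1.1) := (fst _ _).fst'
  have hm : CodeFP RNE unE (fun t => t.1.2.1) := (fst _ _).snd'.fst'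
  have hcg : CodeFP RNE pcE (fun t => t.1.2.2.2) := (fst _ _).snd'.snd'.snd'
  have hrows := rowsOut_codeFP.comp ((hn.pair hm).pair runY_codeFP)
  have hcert := certOK_codeFP.comp (hn.pair (hcg.pair hrows))
  exact (hcert.ite hrows (const _ [])).congr fun _ => rfl

/-- **The finder on mirror-instance codes**: `(t, y) ↦ growCore t |code t| y`. [cite: AroraBarak2009, §1.3] -/
theorem growCore_codeFP : CodeFP (pairE instE strE) matE (fun p => growCore p.1 (instE p.1).length p.2) := by
  have ht : CodeFP (pairE instE strE) instE (fun p => p.1) := fst _ _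
  have hy : CodeFP (pairE instE strE) strE (fun p => p.2) := snd _ _
  have hL1 := unSucc.comp (instLen_codeFP.comp ht)
  have hk := natEq.comp ((instK_codeFP.comp ht).pair (const _ 2))
  have hg := natLeUn.comp ((instN_codeFP.comp ht).pair hL1)
  have hne := unOfNatMin.comp (hL1.pair (instN_codeFP.comp ht))
  have hm := unOfNatMin.comp (hne.pair (natDiv.comp ((natOfUn.comp hne).pair (const _ 2))))
  have hout := outCtx_codeFP.comp ((hne.pair (hm.pair (((circAtC 0).comp ht).pair ((circAtC 1).comp ht)))).pair hy)
  refine ((hk.and hg).ite hout (const _ [])).congr fun p => ?_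
  dsimp only [id]
  rw [min_eq_left (Nat.div_le_self _ 2)]
  simp only [growCore, nEff]

/-- **The finder on genuine instance codes**, output as the register code of its rows:
`(encode I, y) ↦ growCore (instOf I) |encode I| y`. [cite: AroraBarak2009, §1.3] -/
theorem growFindI_codeFP : CodeFP (pairE KForrelationInstance.encode strE) (rawE strE)
    (fun p => growCore (instOf p.1) p.1.encode.length p.2) := by
  have hrows : CodeFP matE (rawE strE) (fun L : Mat => L) := (map₀ bitsToStr).congr fun L => List.map_id' L
  have h := hrows.comp (growCore_codeFP.comp ((instOf_codeFP.comp (fst KForrelationInstance.encode strE)).pair (snd _ _)))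
  refine h.congr fun p => ?_
  simp only [encode_eq]

/-- **The coin finder `growFind`**: a polynomial-time string function agreeing with `growCore` on
`⟨instance code, coins⟩` (by choice from `growFindI_codeFP`). [cite: AroraBarak2009, §1.3] -/
def growFind : List Bool → List Bool := Classical.choose growFindI_codeFP

/-- **`growFind ∈ FP`.** [cite: AroraBarak2009, §1.3] -/
theorem growFind_mem_FP : growFind ∈ FP := (Classical.choose_spec growFindI_codeFP).1

/-- **The value of `growFind` on `⟨encode I, y⟩`**: the register code of the rows of `growCore`. [folklore] -/
theorem growFind_encode (I : KForrelationInstance) (y : List Bool) :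
    growFind (boolPair I.encode y) = encList (growCore (instOf I) I.encode.length y) := by
  refine ((Classical.choose_spec growFindI_codeFP).2 (I, y)).trans ?_
  show encList ((growCore (instOf I) I.encode.length y).map id) = _
  rw [List.map_id]

/-! ### Soundness: a non-empty output spans a certified M-subspace -/

section Sound

open Finset
open Literature.Computability.QuantumComplexity.BuzetChailloux (bxor zeroVec)
open Literature.Computability.Complexity.F2Elim (rowSpan)
open QuadSampler (toInput_zeroL toInput_unitL toInput_bxorL)
open FinderMachine (VL mem_VL_iff zeroVec_mem_VL bxor_mem_VL card_VL)

/-- **A non-empty output passed the guard and `MMReadout.certOK`.** [cite: Carlet2020, Prop. 54] -/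
theorem certOK_of_growCore {t : Inst} {ℓ : ℕ} {y : List Bool} {L : Mat} (h : growCore t ℓ y = L) (hL : L ≠ []) :
    t.1 ≤ ℓ + 1 ∧ certOK (nEff t ℓ) (circAt t 1) L = true := by
  unfold growCore at h
  split_ifs at h with hg
  · simp only [Bool.and_eq_true, decide_eq_true_eq] at hg
    refine ⟨hg.2, ?_⟩
    unfold outCtx at h
    split_ifs at h with hc
    · rw [← h]; exact hc
    · exact absurd h.symm hL
  · exact absurd h.symm hL

/-- **Soundness of `growFind`** (all coin strings): on `⟨encode ⟨m+m, 2, C⟩, y⟩` with cubic circuits, a NON-EMPTY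
output `L` of `growFind` spans an M-subspace of `g = C₁` — `V(L) ∋ 0` is `⊕`-closed, `|V(L)|² = 2ⁿ`, and all second
differences of `g` along `V(L)` vanish. Proof: the output gate only releases rows passing `MMReadout.certOK`
(`certOK_of_growCore`); rank `n/2` gives the count (`FinderMachine.card_VL`), and the unit-point certificate gives the
vanishing on the whole span for a cubic `g` (`stub_certify`), exactly as `FinderMachine.findV2_sound`.
[cite: Carlet2020, Prop. 54] -/
theorem growFind_sound : ∀ (m : ℕ) (C : Fin 2 → Circuit (Fin (m + m))), (∀ i, IsDegLeFun 3 (C i).eval) → ∀ (y : List Bool) (L : List (List Bool)), growFind (boolPair (KForrelationInstance.encode ⟨m + m, 2, C⟩) y) = encList L → L ≠ [] → ((zeroVec ∈ (@Finset.filter (Fin (m + m) → Bool) (fun v => (fun i => if v i then (1 : ZMod 2) else 0) ∈ F2Elim.rowSpan (m + m) L) (Classical.decPred _) Finset.univ) ∧ ∀ x ∈ (@Finset.filter (Fin (m + m) → Bool) (fun v => (fun i => if v i then (1 : ZMod 2) else 0) ∈ F2Elim.rowSpan (m + m) L) (Classical.decPred _) Finset.univ), ∀ y ∈ (@Finset.filter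 (Fin (m + m) → Bool) (fun v => (fun i => if v i then (1 : ZMod 2) else 0) ∈ F2Elim.rowSpan (m + m) L) (Classical.decPred _) Finset.univ), bxor x y ∈ (@Finset.filter (Fin (m + m) → Bool) (fun v => (fun i => if v i then (1 : ZMod 2) else 0) ∈ F2Elim.rowSpan (m + m) L) (Classical.decPred _) Finset.univ)) ∧ ((((@Finset.filter (Fin (m + m) → Bool) (fun v => (fun i => if v i then (1 : ZMod 2) else 0) ∈ F2Elim.rowSpan (m + m) L) (Classical.decPred _) Finset.univ)).card : ℝ) ^ 2 = (2 : ℝ) ^ (m + m)) ∧ ∀ u ∈ (@Finset.filter (Fin (m + m) → Bool) (fun v => (fun i => if v i then (1 : ZMod 2) else 0) ∈ F2Elim.rowSpan (m + m) L) (Classical.decPred _) Finset.univ), ∀ v ∈ (@Finset.filter (Fin (m + m) → Bool) (fun v => (fun i => if v i then (1 : ZMod 2) else 0) ∈ F2Elim.rowSpan (m + m) L) (Classical.decPred _) Finset.univ), ∀ x, ((C 1).eval x ^^ (C 1).eval (bxor x u) ^^ (C 1).eval (bxor x v) ^^ (C 1).eval (bxor x (bxor u v))) = false) := by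
  intro m C hdeg y L hfind hL
  set I : KForrelationInstance := ⟨m + m, 2, C⟩ with hI
  rw [growFind_encode] at hfind
  have hLeq : growCore (instOf I) I.encode.length y = L := by
    have h := congrArg Brick.decNil hfind
    rwa [Brick.decNil_encList, Brick.decNil_encList] at h
  obtain ⟨hn, hcert⟩ := certOK_of_growCore hLeq hL
  have hnI : nEff (instOf I) I.encode.length = m + m := min_eq_left hn
  have hc1 : circAt (instOf I) 1 = pcircOf (C 1) := circAt_instOf I (1 : Fin 2)
  rw [hnI, hc1] at hcert
  simp only [certOK, Bool.and_eq_true, decide_eq_true_eq, List.all_eq_true, Bool.not_eq_true'] at hcert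
  obtain ⟨hrank, haff⟩ := hcert
  -- the unit-point certificate, read in `{0,1}ⁿ`
  have hrows : ∀ r ∈ L, ∀ s ∈ L, ∀ y : Fin (m + m) → Bool, (y = zeroVec ∨ ∃ i : Fin (m + m), y = fun j => decide (j = i)) →
      ((C 1).eval y ^^ (C 1).eval (bxor y (fun i => r.getD i false)) ^^ (C 1).eval (bxor y (fun i => s.getD i false)) ^^
        (C 1).eval (bxor y (bxor (fun i => r.getD i false) (fun i => s.getD i false)))) = false := by
    intro r hr s hs y hy
    have key : ∀ yl ∈ unitPts (m + m), ((C 1).eval (toInput (m + m) yl) ^^ (C 1).eval (bxor (toInput (m + m) yl) (toInput (m + m) r)) ^^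
        (C 1).eval (bxor (toInput (m + m) yl) (toInput (m + m) s)) ^^
        (C 1).eval (bxor (toInput (m + m) yl) (bxor (toInput (m + m) r) (toInput (m + m) s)))) = false := by
      intro yl hyl
      have h := haff (r, s) (List.pair_mem_product.2 ⟨hr, hs⟩) yl hyl
      simp only [d2, evalP_pcircOf_eq, toInput_bxorL] at h
      exact h
    rcases hy with rfl | ⟨i, rfl⟩
    · have h := key (zeroL (m + m)) List.mem_cons_self
      rwa [toInput_zeroL] at h
    · have h := key (unitL (m + m) i) (List.mem_cons_of_mem _ (List.mem_map.2 ⟨i, List.mem_range.2 i.isLt, rfl⟩))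
      rwa [toInput_unitL] at h
  refine ⟨⟨zeroVec_mem_VL L, fun x hx y hy => bxor_mem_VL hx hy⟩, ?_, fun u hu v hv x => ?_⟩
  · rw [card_VL]
    push_cast
    rw [← pow_mul]
    exact congrArg (fun k : ℕ => (2 : ℝ) ^ k) (by omega)
  · exact SignedCubicForrelationInPrBPP.stub_certify (m + m) _ (hdeg 1) L hrows u v ((mem_VL_iff L u).1 hu) ((mem_VL_iff L v).1 hv) x

end Sound

end Summit.QuantumAdvantage.QuantumAdvantage.Theorems.SignedExactCubicForrelationNotPrBPP.GrowMachine

end
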